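import Summits.CriticalPhenomena.PercolationContinuityZ3.Theses.PercNearOneGluing
import Literature.Probability.Percolation.PercolationEvents
import HarnessLib.Audit
import Summits.CriticalPhenomena.PercolationContinuityZ3.Theorems.PercNearOneGluingAdditiveGluingOneBond
import Summits.CriticalPhenomena.PercolationContinuityZ3.Theorems.PercNearOneGluingNearOneGluingPivotalityDomination
import Summits.CriticalPhenomena.PercolationContinuityZ3.Theorems.PercNearOneGluingNearOneGluingVariants2415

/-! TTRL-lite variant V2443 of stmt-CriticalPhenomena-4574

(`stub_shorteningStep` of line `kn_shortening_induction`, move `small_case+small_case`: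
`n ≤ 4` and `A.card = 3`).  Reduction to the landed two-relay sibling V2415
(`stub_shorteningStep_var2415`, `A.card ≤ 2`):
* `A ⊆ univ.erase v` has `3` elements while `univ.erase v` has `n - 1 ≤ 3`, so
  `A = univ.erase v`, and `x ≠ v` gives `x ∈ A`;
* V2415 applied to the relay pair `A' = {a₀, x} ⊆ A` (the minimiser hypothesis restricts to `A'`,
  the induction hypothesis is passed through unchanged) gives
  `μ₁(⋃ a ∈ A', v ↔ a) · μ₁(a₀ ↔ b) ≤ μ₁(v ↔ b)` for the glued measure
  `μ₁ = prodBernoulli (w[s(v,x) ↦ 1])`;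
* under `μ₁` the glued pair is open almost surely (`μ₁` is the image of `prodBernoulli w` under
  `ω ↦ insert s(v,x) ω`, `goodStepEI_prodBernoulli_map_insert`), so `μ₁(v ↔ x) = 1` and hence
  `μ₁(⋃ a ∈ A, v ↔ a) ≤ 1 = μ₁(v ↔ x) ≤ μ₁(⋃ a ∈ A', v ↔ a)`.
No new definitions, no named facts. -/

namespace Summit.CriticalPhenomena.PercolationContinuityZ3.Theorems

open MeasureTheory Set Literature.Probability.LatticeModels Literature.Probability.Percolation
open scoped Classical BigOperators

/-- TTRL-lite variant V2443 of `stub_shorteningStep` (stmt-CriticalPhenomena-4574, Kozma–Nitzan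
shortening step with the induction hypothesis displayed): the inequality
`μ₁(⋃ a ∈ A, v ↔ a) · μ₁(a₀ ↔ b) ≤ μ₁(v ↔ b)` for the glued measure
`μ₁ = prodBernoulli (w[s(v,x) ↦ 1])` in the small case `n ≤ 4`, `A.card = 3`.  Then
`A = univ.erase v ∋ x`, the glued vertex `x` is itself a relay, `μ₁(v ↔ x) = 1`, and the claim
follows from the two-relay case `A' = {a₀, x}` (`stub_shorteningStep_var2415`). -/
theorem stub_shorteningStep_var2443 : ∀ (n : ℕ) (w : Sym2 (Fin n) → unitInterval) (A : Finset (Fin n)) (b v x a₀ : Fin n), A.card = 3 → n ≤ 4 → v ∉ A → v ≠ x → w s(v, x) = 0 → a₀ ∈ A → (∀ a ∈ A, (prodBernoulli w).real (openConn a₀ b) ≤ (prodBernoulli w).real (openConn a b)) → (∀ w' : Sym2 (Fin n) → unitInterval, (∀ e, w e = 0 → w' e = 0) → ∀ (A' : Finset (Fin n)) (o' b' : Fin n) (t : ℝ), (∀ a ∈ A', t ≤ (prodBernoulli w').real (openConn a b')) → (prodBernoulli w').real (⋃ a ∈ A', openConn o' a) * t ≤ (prodBernoulli w').real (openConn o'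 b')) → (prodBernoulli (Function.update w s(v, x) 1)).real (⋃ a ∈ A, openConn v a) * (prodBernoulli (Function.update w s(v, x) 1)).real (openConn a₀ b) ≤ (prodBernoulli (Function.update w s(v, x) 1)).real (openConn v b) := by
  intro n w A b v x a₀ hcard hn hvA hvx hw0 ha₀ hmin hIH
  -- `A ⊆ univ.erase v` has `3` elements, `univ.erase v` has `n - 1 ≤ 3`, so `A = univ.erase v ∋ x`
  have hxA : x ∈ A := by
    have hsub : A ⊆ Finset.univ.erase v := fun a ha =>
      Finset.mem_erase.2 ⟨ne_of_mem_of_not_mem ha hvA, Finset.mem_univ a⟩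
    have hcard' : (Finset.univ.erase v : Finset (Fin n)).card = n - 1 := by
      rw [Finset.card_erase_of_mem (Finset.mem_univ v), Finset.card_univ, Fintype.card_fin]
    have heq : A = Finset.univ.erase v :=
      Finset.eq_of_subset_of_card_le hsub (by rw [hcard', hcard]; omega)
    rw [heq]
    exact Finset.mem_erase.2 ⟨fun h => hvx h.symm, Finset.mem_univ x⟩
  -- the two-relay case `A' = {a₀, x}` (sibling variant V2415)
  have hmin' : ∀ a ∈ ({a₀, x} : Finset (Fin n)),
      (prodBernoulli w).real (openConn a₀ b) ≤ (prodBernoulli w).real (openConn a b) := by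
    intro a ha
    simp only [Finset.mem_insert, Finset.mem_singleton] at ha
    rcases ha with ha | ha
    · rw [ha]
    · rw [ha]; exact hmin x hxA
  have hvA' : v ∉ ({a₀, x} : Finset (Fin n)) := by
    simp only [Finset.mem_insert, Finset.mem_singleton, not_or]
    exact ⟨(ne_of_mem_of_not_mem ha₀ hvA).symm, hvx⟩
  have key := stub_shorteningStep_var2415 n w ({a₀, x} : Finset (Fin n)) b v x a₀
    Finset.card_le_two hvA' hvx hw0 (by simp) hmin' hIH
  -- the glued pair is open almost surely under `μ₁`, so `μ₁(v ↔ x) = 1`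
  have hmeas : ∀ S : Set (BondConfig (Fin n)), MeasurableSet S := fun S =>
    MeasurableSet.of_discrete
  have hmi : Measurable fun ω : BondConfig (Fin n) => insert s(v, x) ω := by
    refine measurable_set_iff.2 fun i => ?_
    simp only [Set.mem_insert_iff]
    exact measurable_const.or (measurable_set_mem i)
  have hone : (prodBernoulli (Function.update w s(v, x) 1)).real (openConn v x) = 1 := by
    rw [← goodStepEI_prodBernoulli_map_insert w s(v, x), map_measureReal_apply hmi (hmeas _)]
    have huniv : (fun ω : BondConfig (Fin n) => insert s(v, x) ω) ⁻¹' (openConn v x) = Set.univ :=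
      Set.eq_univ_of_forall fun ω =>
        pivDom_reachable_insert_of ω hvx (SimpleGraph.Reachable.refl x)
    rw [huniv, probReal_univ]
  have hle : (prodBernoulli (Function.update w s(v, x) 1)).real (⋃ a ∈ A, openConn v a) ≤
      (prodBernoulli (Function.update w s(v, x) 1)).real
        (⋃ a ∈ ({a₀, x} : Finset (Fin n)), openConn v a) :=
    calc (prodBernoulli (Function.update w s(v, x) 1)).real (⋃ a ∈ A, openConn v a)
        ≤ 1 := measureReal_le_one
      _ = (prodBernoulli (Function.update w s(v, x) 1)).real (openConn v x) := hone.symm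
      _ ≤ (prodBernoulli (Function.update w s(v, x) 1)).real
            (⋃ a ∈ ({a₀, x} : Finset (Fin n)), openConn v a) := by
          refine measureReal_mono (fun ω hω => ?_) (measure_ne_top _ _)
          simp only [Set.mem_iUnion, exists_prop]
          exact ⟨x, by simp, hω⟩
  -- assemble
  calc (prodBernoulli (Function.update w s(v, x) 1)).real (⋃ a ∈ A, openConn v a) *
        (prodBernoulli (Function.update w s(v, x) 1)).real (openConn a₀ b)
      ≤ (prodBernoulli (Function.update w s(v, x) 1)).real
            (⋃ a ∈ ({a₀, x} : Finset (Fin n)), openConn v a) *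
          (prodBernoulli (Function.update w s(v, x) 1)).real (openConn a₀ b) :=
        mul_le_mul_of_nonneg_right hle measureReal_nonneg
    _ ≤ (prodBernoulli (Function.update w s(v, x) 1)).real (openConn v b) := key

end Summit.CriticalPhenomena.PercolationContinuityZ3.Theorems
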